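import Mathlib
import Summits.AtomisticToContinuum.HydrodynamicLimit.Theorems.InformationPercolationEngineKickFairRelEquilibriumMesoSameWindowPairCovConstSplit
import Summits.AtomisticToContinuum.HydrodynamicLimit.Theorems.InformationPercolationEngineKickFairRelEquilibriumMesoCutCount
import Summits.AtomisticToContinuum.HydrodynamicLimit.Theorems.InformationPercolationEngineKickFairRelEquilibriumMesoWindowCut
import Summits.AtomisticToContinuum.HydrodynamicLimit.Theorems.InformationPercolationEngineKickFairRelEquilibriumMesoLongWindowDefs
import HarnessLib

/-!
# `KickFairRelEquilibriumMeso`, line `kinetic-window-cut` (rev 5) — the pathwise long same-window pair count and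
# SWL at constant profiles from pure decorrelation (worker W5, wave 1; lead c8)

Prover file (`--supports stmt-AtomisticToContinuum-15177`) for the two registered stubs

* `longSameWindowPairCount_le` — PATHWISE, on the good set and where the cut is genuine (`n < cnt_i → t_{i,n} ∈ (0, τ]`),
  the number of ordered pairs `((i,n),(i',n'))` of LONG-flight kicks (`IsLong A t_N`: flight `≥ t_N / A`) lying in the SAME
  kinetic window (`⌊t_{i,n}/t_N⌋ = ⌊t_{i',n'}/t_N⌋`) is at most `(⌊τ/t_N⌋₊ + 1) ((A+1)(N+1))²`;
* `sameWindowPairCovLongConst_of_decorrelation : FarPairDecorrelationLongConst rs → SameWindowPairCovLongConst rs` — at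
  constant profiles SWL (far same-window pairs of long kicks charged `|Γ|`, `N^{1/3}`-normalised) follows from the PURE
  decorrelation input alone: the count input of rev 3's split (`sameWindowPairCovConst_of_count_of_decorrelation`) is gone.

Proofs. (1) A window `{x | v = ⌊x/t_N⌋}` has diameter `≤ t_N`, so by the counting step of `stub_cutCount` (copied here for
windows given as a set of diameter `≤ t_N` instead of an interval `(t₁, t₁ + t_N]`: `sum_indicator_longFlight_le_of_diam`,
`cutCount_of_diam`) every sphere has at most `A + 1` long kicks in it. Hence for a fixed long kick `(i,n)` the inner sum over
`(i',n')` is `≤ (N+1)(A+1)`, and the number of long kicks `(i,n)`, `n < cnt_i`, binned by the `⌊τ/t_N⌋₊ + 1` windows meeting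
`(0, τ]`, is `≤ (⌊τ/t_N⌋₊ + 1)(N+1)(A+1)`. (2) Pointwise `1_{LL far}|Γ| ≤ η 1_{LL sw} + 1_{LL far}(|Γ| − η)₊` (`far_term_le`,
`sum4_split_le`); on the `LG`-full set where the datum is good and the cut is genuine (`ae_forall_lt_cnt_iff_pastTime`) the
normalised count is `≤ (N+1)^{1/3}(σ t_N/(N+1))² (⌊τ/t_N⌋₊ + 1)((A+1)(N+1))² ≤ σ²(A+1)²(τ+1) =: B` (`card_windows_le`,
`(N+1)^{1/3} t_N = 1`), so `E ≤ η B + η ≤ δ` for `η = δ/(B+1)` (`lintegral_mono_ae`, `lintegral_add_left` with a constant).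
-/

noncomputable section

open MeasureTheory Set Filter Topology
open scoped ENNReal Classical

namespace Summit.AtomisticToContinuum.HydrodynamicLimit.Theorems.KickFairRelEquilibriumMesoLine

open Literature.Analysis.FluidPDE Literature.MathematicalPhysics.KineticTheory

variable {σ : ℝ} {N : ℕ}

/-! ## The counting step for a window of bounded diameter -/

/-- **The counting step, set form.** As `sum_indicator_longFlight_le`, with the window `(t₁, t₂]`, `t₂ ≤ t₁ + T`, replaced
by any set `W` of diameter `≤ T` (`y − x ≤ T` for `x, y ∈ W`): the number of `n < c` with `t n ∈ W` and flight
`t n − fs n ≥ T / A` is at most `A + 1` — all but the first such `n` have gap `t n − t (n−1) ≥ T / A`, and the gaps over the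
consecutive indices between the first and the last telescope to `t last − t first ≤ T`. [folklore] -/
theorem sum_indicator_longFlight_le_of_diam {t fs : ℕ → ℝ} {c : ℕ} {T A : ℝ} (W : Set ℝ) (hA : 0 < A) (hT : 0 < T)
    (hmono : ∀ ⦃a b : ℕ⦄, a < c → b < c → a < b → t a < t b)
    (hfs : ∀ n, 1 ≤ n → n < c → t (n - 1) ≤ fs n) (hW : ∀ x ∈ W, ∀ y ∈ W, y - x ≤ T) :
    ∑ n ∈ Finset.range c, ((if t n ∈ W then (1 : ℝ) else 0) *
        (if T / A ≤ t n - fs n then (1 : ℝ) else 0)) ≤ A + 1 := by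
  set L : ℝ := T / A with hL
  have hL0 : 0 < L := div_pos hT hA
  set J : Finset ℕ := (Finset.range c).filter (fun n => t n ∈ W ∧ L ≤ t n - fs n) with hJ
  -- the sum is the cardinality of `J`
  have hsum : ∑ n ∈ Finset.range c, ((if t n ∈ W then (1 : ℝ) else 0) *
      (if L ≤ t n - fs n then (1 : ℝ) else 0)) = (J.card : ℝ) := by
    rw [hJ, Finset.natCast_card_filter]
    refine Finset.sum_congr rfl fun n _ => ?_
    rw [ite_zero_mul_ite_zero, one_mul]
  rw [hsum]
  have hmemJ : ∀ {n : ℕ}, n ∈ J → n < c ∧ t n ∈ W ∧ L ≤ t n - fs n := fun hn => by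
    simpa [hJ, Finset.mem_filter, Finset.mem_range] using hn
  rcases J.eq_empty_or_nonempty with hJe | hJne
  · rw [hJe, Finset.card_empty, Nat.cast_zero]
    linarith
  -- the first and the last index in `J`
  obtain ⟨-, hn₀W, -⟩ := hmemJ (J.min'_mem hJne)
  obtain ⟨hmc, hmW, -⟩ := hmemJ (J.max'_mem hJne)
  have hlt_of : ∀ {n : ℕ}, n ∈ J.erase (J.min' hJne) → J.min' hJne < n ∧ n ∈ J := fun {n} hn => by
    obtain ⟨hne, hnJ⟩ := Finset.mem_erase.1 hn
    exact ⟨lt_of_le_of_ne (J.min'_le n hnJ) (Ne.symm hne), hnJ⟩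
  -- (#J - 1) · L ≤ Σ_{J ∖ {min}} gaps ≤ Σ_{(min, max]} gaps = t max - t min ≤ T
  have hkey : ((J.erase (J.min' hJne)).card : ℝ) * L ≤ T :=
    calc ((J.erase (J.min' hJne)).card : ℝ) * L = ∑ _n ∈ J.erase (J.min' hJne), L := by
          rw [Finset.sum_const, nsmul_eq_mul]
      _ ≤ ∑ n ∈ J.erase (J.min' hJne), (t n - t (n - 1)) := by
          refine Finset.sum_le_sum fun n hn => ?_
          obtain ⟨hn₀n, hnJ⟩ := hlt_of hn
          obtain ⟨hnc, -, hnL⟩ := hmemJ hnJ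
          have h1 : 1 ≤ n := Nat.succ_le_of_lt (lt_of_le_of_lt (Nat.zero_le _) hn₀n)
          have := hfs n h1 hnc
          linarith
      _ ≤ ∑ n ∈ Finset.Ioc (J.min' hJne) (J.max' hJne), (t n - t (n - 1)) := by
          refine Finset.sum_le_sum_of_subset_of_nonneg (fun n hn => ?_) (fun n hn _ => ?_)
          · obtain ⟨hn₀n, hnJ⟩ := hlt_of hn
            exact Finset.mem_Ioc.2 ⟨hn₀n, J.le_max' n hnJ⟩
          · obtain ⟨hn₀n, hnm⟩ := Finset.mem_Ioc.1 hn
            have hnc : n < c := lt_of_le_of_lt hnm hmc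
            have h1 : n - 1 < n := Nat.sub_lt (lt_of_le_of_lt (Nat.zero_le _) hn₀n) Nat.one_pos
            have := hmono (lt_trans h1 hnc) hnc h1
            linarith
      _ = t (J.max' hJne) - t (J.min' hJne) :=
          sum_Ioc_sub_pred_eq t (J.min'_le _ (J.max'_mem hJne))
      _ ≤ T := hW _ hn₀W _ hmW
  -- hence #J - 1 ≤ A
  have hcard : ((J.erase (J.min' hJne)).card : ℝ) ≤ A := by
    rw [hL, mul_div_assoc', div_le_iff₀ hA, mul_comm T A] at hkey
    exact le_of_mul_le_mul_right hkey hT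
  have hJcard : (J.card : ℝ) = ((J.erase (J.min' hJne)).card : ℝ) + 1 := by
    rw [← Finset.card_erase_add_one (J.min'_mem hJne)]
    push_cast
    ring
  linarith

/-- **At most `A + 1` long-flight kicks of one sphere in a window of diameter `≤ t_N`** (the set form of `stub_cutCount`,
with the window read off the typed past): on the good set the typed past carries the collision time `t_{i,n}` and the flight
start `s_i ≥ t_{i,n-1}` of `i`, and `n ↦ t_{i,n}` increases strictly below `cnt_i`. [folklore] -/
theorem cutCount_of_diam (Φ : Flow σ N) (τ r : ℝ) {A : ℝ} (hA : 0 < A) (W : Set ℝ)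
    (hW : ∀ x ∈ W, ∀ y ∈ W, y - x ≤ tN N) {z : Phase N} (hz : z ∈ Φ.good) (i : Fin (N + 1)) :
    ∑ n ∈ Finset.range (cnt Φ τ z i),
        (if IsLong A (tN N) (past Φ r z i n) ∧ (past Φ r z i n).2.2.2 ∈ W then (1 : ℝ) else 0) ≤ A + 1 := by
  -- the collision times of `i` along the (good) orbit of `z`
  set S : Set ℝ := collisionTimesOf (Torus.geometry (Fin 3)) (hsDiameter σ N) (fun s => Φ.flow s z) i with hS
  have htraj := Φ.isTrajectory z hz
  -- on the good set the typed past carries the collision time and the flight start of `i`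
  have hiff : ∀ n : ℕ, (IsLong A (tN N) (past Φ r z i n) ∧ (past Φ r z i n).2.2.2 ∈ W) ↔
      (Φ.nthCollisionTimeOf i n z ∈ W ∧ tN N / A ≤ Φ.nthCollisionTimeOf i n z -
        flightStart (Torus.geometry (Fin 3)) (hsDiameter σ N) (fun s => Φ.flow s z) 0 i
          (Φ.nthCollisionTimeOf i n z)) := by
    intro n
    have h1 : (past Φ r z i n).2.2.2 = Φ.nthCollisionTimeOf i n z := by simp [past, hz]
    have h2 : (past Φ r z i n).2.1 =
        flightStart (Torus.geometry (Fin 3)) (hsDiameter σ N) (fun s => Φ.flow s z) 0 i (Φ.nthCollisionTimeOf i n z) := by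
      simp [past, hz]
    simp only [IsLong]
    rw [h2, h1]
    exact and_comm
  -- the enumeration is strictly increasing below `cnt`
  have hmono : ∀ ⦃a b : ℕ⦄, a < cnt Φ τ z i → b < cnt Φ τ z i → a < b →
      Φ.nthCollisionTimeOf i a z < Φ.nthCollisionTimeOf i b z := fun a b ha hb hab =>
    strictMonoOn_nthTimeAfter_of_ncard (S := S) (a := 0) (b := τ) ha hb hab
  -- the flight ending at the `n`-th collision starts no earlier than the `(n-1)`-st collision
  have hfs : ∀ n : ℕ, 1 ≤ n → n < cnt Φ τ z i →
      Φ.nthCollisionTimeOf i (n - 1) z ≤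
        flightStart (Torus.geometry (Fin 3)) (hsDiameter σ N) (fun s => Φ.flow s z) 0 i
          (Φ.nthCollisionTimeOf i n z) := by
    intro n h1 hn
    have hn' : n - 1 < cnt Φ τ z i := lt_of_lt_of_le (Nat.sub_lt h1 Nat.one_pos) hn.le
    have hmem : nthTimeAfter S 0 (n - 1) ∈ S ∩ Ioc 0 τ :=
      nthTimeAfter_mem_of_lt_ncard (S := S) (a := 0) (b := τ) hn'
    have hlt : Φ.nthCollisionTimeOf i (n - 1) z < Φ.nthCollisionTimeOf i n z :=
      hmono hn' hn (Nat.sub_lt h1 Nat.one_pos)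
    exact le_flightStart_of_mem (htraj.finite_collisionTimesOf_inter_Ioo i 0 _) hmem.1 hmem.2.1 hlt
  calc ∑ n ∈ Finset.range (cnt Φ τ z i),
        (if IsLong A (tN N) (past Φ r z i n) ∧ (past Φ r z i n).2.2.2 ∈ W then (1 : ℝ) else 0)
      = ∑ n ∈ Finset.range (cnt Φ τ z i), ((if Φ.nthCollisionTimeOf i n z ∈ W then (1 : ℝ) else 0) *
          (if tN N / A ≤ Φ.nthCollisionTimeOf i n z -
              flightStart (Torus.geometry (Fin 3)) (hsDiameter σ N) (fun s => Φ.flow s z) 0 i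
                (Φ.nthCollisionTimeOf i n z) then (1 : ℝ) else 0)) :=
        Finset.sum_congr rfl fun n _ => by
          rw [ite_zero_mul_ite_zero, one_mul]
          exact if_congr (hiff n) rfl rfl
    _ ≤ A + 1 := sum_indicator_longFlight_le_of_diam (t := fun n => Φ.nthCollisionTimeOf i n z)
        (fs := fun n => flightStart (Torus.geometry (Fin 3)) (hsDiameter σ N) (fun s => Φ.flow s z) 0 i
          (Φ.nthCollisionTimeOf i n z)) W hA (tN_pos N) hmono hfs hW

/-- A floor window `{x | v = ⌊x / t_N⌋}` has diameter `≤ t_N`. [folklore] -/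
theorem floorWindow_diam (N : ℕ) (v : ℤ) :
    ∀ x ∈ {x : ℝ | v = ⌊x / tN N⌋}, ∀ y ∈ {x : ℝ | v = ⌊x / tN N⌋}, y - x ≤ tN N := by
  intro x hx y hy
  simp only [Set.mem_setOf_eq] at hx hy
  have htN := tN_pos N
  have h1 : (v : ℝ) ≤ x / tN N := by rw [hx]; exact Int.floor_le _
  have h2 : y / tN N < (v : ℝ) + 1 := by rw [hy]; exact Int.lt_floor_add_one _
  rw [le_div_iff₀ htN] at h1
  rw [div_lt_iff₀ htN] at h2
  linarith

/-! ## The registered stub: the pathwise long same-window pair count -/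

/-- **STUB `longSameWindowPairCount_le` — THE NUMBER OF SAME-WINDOW ORDERED PAIRS OF LONG-FLIGHT KICKS IS AT MOST
`(⌊τ/t_N⌋₊ + 1)((A+1)(N+1))²`, PATHWISE** (registered sub-goal of the line `kinetic-window-cut`, rev 5; combinatorial).
On the good set, where the cut is genuine (`n < cnt_i → t_{i,n} ∈ (0, τ]`): for a fixed long kick `(i, n)` every sphere `i'`
has at most `A + 1` long kicks in the window of `t_{i,n}` (`cutCount_of_diam`), so the inner sum is `≤ (N+1)(A+1)`; and the
long kicks `(i, n)`, binned by the `⌊τ/t_N⌋₊ + 1` floor windows meeting `(0, τ]`, number `≤ (⌊τ/t_N⌋₊ + 1)(N+1)(A+1)`.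
[folklore] -/
theorem longSameWindowPairCount_le : ∀ (σ : ℝ) (N : ℕ) (Φ : Flow σ N) (τ r A : ℝ), 0 < A →
    ∀ z : Phase N, z ∈ Φ.good → (∀ i : Fin (N + 1), ∀ n : ℕ, n < cnt Φ τ z i → Φ.nthCollisionTimeOf i n z ∈ Set.Ioc 0 τ) →
    ∑ i : Fin (N + 1), ∑ n ∈ Finset.range (cnt Φ τ z i), ∑ i' : Fin (N + 1), ∑ n' ∈ Finset.range (cnt Φ τ z i'),
        (if IsLong A (tN N) (past Φ r z i n) ∧ IsLong A (tN N) (past Φ r z i' n') ∧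
            SameWindow (tN N) (past Φ r z i n) (past Φ r z i' n') then (1 : ℝ) else 0)
      ≤ ((⌊τ / tN N⌋₊ : ℝ) + 1) * ((A + 1) * ((N : ℝ) + 1)) ^ 2 := by
  intro σ N Φ τ r A hA z hz hgen
  have htN := tN_pos N
  -- the long-flight indicator of `(i, n)`
  set L : Fin (N + 1) → ℕ → ℝ := fun i n => if IsLong A (tN N) (past Φ r z i n) then (1 : ℝ) else 0 with hLdef
  -- Step A: for a fixed kick `(i, n)` the inner sum is `≤ 1_L(i,n) (N+1)(A+1)`
  have hinner : ∀ (i : Fin (N + 1)) (n : ℕ), ∑ i' : Fin (N + 1), ∑ n' ∈ Finset.range (cnt Φ τ z i'),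
        (if IsLong A (tN N) (past Φ r z i n) ∧ IsLong A (tN N) (past Φ r z i' n') ∧
            SameWindow (tN N) (past Φ r z i n) (past Φ r z i' n') then (1 : ℝ) else 0) ≤
      L i n * (((N : ℝ) + 1) * (A + 1)) := by
    intro i n
    by_cases hL : IsLong A (tN N) (past Φ r z i n)
    · have h1 : L i n = 1 := by simp only [hLdef, hL, if_true]
      rw [h1, one_mul]
      calc ∑ i' : Fin (N + 1), ∑ n' ∈ Finset.range (cnt Φ τ z i'),
            (if IsLong A (tN N) (past Φ r z i n) ∧ IsLong A (tN N) (past Φ r z i' n') ∧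
              SameWindow (tN N) (past Φ r z i n) (past Φ r z i' n') then (1 : ℝ) else 0)
          ≤ ∑ _i' : Fin (N + 1), (A + 1) := Finset.sum_le_sum fun i' _ => ?_
        _ = ((N : ℝ) + 1) * (A + 1) := by
            rw [Finset.sum_const, Finset.card_univ, Fintype.card_fin, nsmul_eq_mul]
            push_cast
            ring
      refine le_trans (le_of_eq (Finset.sum_congr rfl fun n' _ => ?_))
        (cutCount_of_diam Φ τ r hA {x : ℝ | ⌊(past Φ r z i n).2.2.2 / tN N⌋ = ⌊x / tN N⌋} (floorWindow_diam N _) hz i')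
      simp only [hL, true_and]
      rfl
    · have h0 : L i n = 0 := by simp only [hLdef, hL, if_false]
      rw [h0, zero_mul]
      refine le_of_eq (Finset.sum_eq_zero fun i' _ => Finset.sum_eq_zero fun n' _ => ?_)
      rw [if_neg (fun h => hL h.1)]
  -- Step B: the number of long kicks, binned by the windows meeting `(0, τ]`
  have hwin : ∀ (i : Fin (N + 1)), ∀ n ∈ Finset.range (cnt Φ τ z i), L i n ≤
      ∑ v ∈ Finset.range (⌊τ / tN N⌋₊ + 1),
        (if IsLong A (tN N) (past Φ r z i n) ∧ (past Φ r z i n).2.2.2 ∈ {x : ℝ | ((v : ℕ) : ℤ) = ⌊x / tN N⌋}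
          then (1 : ℝ) else 0) := by
    intro i n hn
    have ht := hgen i n (Finset.mem_range.1 hn)
    have hpt : (past Φ r z i n).2.2.2 = Φ.nthCollisionTimeOf i n z := by simp [past, hz]
    have ht0 : 0 ≤ Φ.nthCollisionTimeOf i n z / tN N := div_nonneg ht.1.le htN.le
    have hv₀mem : ⌊Φ.nthCollisionTimeOf i n z / tN N⌋₊ ∈ Finset.range (⌊τ / tN N⌋₊ + 1) :=
      Finset.mem_range.2 (Nat.lt_succ_of_le (Nat.floor_le_floor (div_le_div_of_nonneg_right ht.2 htN.le)))
    have hv₀ : ((⌊Φ.nthCollisionTimeOf i n z / tN N⌋₊ : ℕ) : ℤ) = ⌊Φ.nthCollisionTimeOf i n z / tN N⌋ :=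
      Int.natCast_floor_eq_floor ht0
    have hmem : (past Φ r z i n).2.2.2 ∈
        {x : ℝ | ((⌊Φ.nthCollisionTimeOf i n z / tN N⌋₊ : ℕ) : ℤ) = ⌊x / tN N⌋} := by
      rw [Set.mem_setOf_eq, hpt, hv₀]
    refine le_trans (le_of_eq ?_) (Finset.single_le_sum (fun v _ => ?_) hv₀mem)
    · simp only [hLdef, hmem, and_true]
    · positivity
  have hcountL : ∑ i : Fin (N + 1), ∑ n ∈ Finset.range (cnt Φ τ z i), L i n ≤
      ((⌊τ / tN N⌋₊ : ℝ) + 1) * (((N : ℝ) + 1) * (A + 1)) :=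
    calc ∑ i : Fin (N + 1), ∑ n ∈ Finset.range (cnt Φ τ z i), L i n
        ≤ ∑ i : Fin (N + 1), ∑ n ∈ Finset.range (cnt Φ τ z i), ∑ v ∈ Finset.range (⌊τ / tN N⌋₊ + 1),
            (if IsLong A (tN N) (past Φ r z i n) ∧ (past Φ r z i n).2.2.2 ∈ {x : ℝ | ((v : ℕ) : ℤ) = ⌊x / tN N⌋}
              then (1 : ℝ) else 0) := Finset.sum_le_sum fun i _ => Finset.sum_le_sum (hwin i)
      _ = ∑ v ∈ Finset.range (⌊τ / tN N⌋₊ + 1), ∑ i : Fin (N + 1), ∑ n ∈ Finset.range (cnt Φ τ z i),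
            (if IsLong A (tN N) (past Φ r z i n) ∧ (past Φ r z i n).2.2.2 ∈ {x : ℝ | ((v : ℕ) : ℤ) = ⌊x / tN N⌋}
              then (1 : ℝ) else 0) := by
          rw [Finset.sum_comm]
          exact Finset.sum_congr rfl fun i _ => Finset.sum_comm
      _ ≤ ∑ _v ∈ Finset.range (⌊τ / tN N⌋₊ + 1), ∑ _i : Fin (N + 1), (A + 1) := by
          refine Finset.sum_le_sum fun v _ => Finset.sum_le_sum fun i _ => ?_
          -- (the window membership is decided by `decidableSetOf` here, classically in `cutCount_of_diam`)
          refine le_trans (le_of_eq (Finset.sum_congr rfl fun n _ => ?_))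
            (cutCount_of_diam Φ τ r hA {x : ℝ | ((v : ℕ) : ℤ) = ⌊x / tN N⌋} (floorWindow_diam N _) hz i)
          exact @if_congr _ _ _ (_) (_) _ _ _ _ Iff.rfl rfl rfl
      _ = ((⌊τ / tN N⌋₊ : ℝ) + 1) * (((N : ℝ) + 1) * (A + 1)) := by
          simp only [Finset.sum_const, Finset.card_univ, Fintype.card_fin, Finset.card_range, nsmul_eq_mul]
          push_cast
          ring
  -- assemble
  calc ∑ i : Fin (N + 1), ∑ n ∈ Finset.range (cnt Φ τ z i), ∑ i' : Fin (N + 1), ∑ n' ∈ Finset.range (cnt Φ τ z i'),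
        (if IsLong A (tN N) (past Φ r z i n) ∧ IsLong A (tN N) (past Φ r z i' n') ∧
            SameWindow (tN N) (past Φ r z i n) (past Φ r z i' n') then (1 : ℝ) else 0)
      ≤ ∑ i : Fin (N + 1), ∑ n ∈ Finset.range (cnt Φ τ z i), L i n * (((N : ℝ) + 1) * (A + 1)) :=
        Finset.sum_le_sum fun i _ => Finset.sum_le_sum fun n _ => hinner i n
    _ = (∑ i : Fin (N + 1), ∑ n ∈ Finset.range (cnt Φ τ z i), L i n) * (((N : ℝ) + 1) * (A + 1)) := by
        rw [Finset.sum_mul]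
        exact Finset.sum_congr rfl fun i _ => (Finset.sum_mul _ _ _).symm
    _ ≤ ((⌊τ / tN N⌋₊ : ℝ) + 1) * (((N : ℝ) + 1) * (A + 1)) * (((N : ℝ) + 1) * (A + 1)) :=
        mul_le_mul_of_nonneg_right hcountL (by positivity)
    _ = ((⌊τ / tN N⌋₊ : ℝ) + 1) * ((A + 1) * ((N : ℝ) + 1)) ^ 2 := by ring

/-! ## SWL at constant profiles from pure decorrelation -/

/-- **The normalisation pays the windows and the `(N+1)²` pairs**:
`(N+1)^{1/3} (ε/(N+1))² (⌊τ/t_N⌋₊ + 1) ((A+1)(N+1))² ≤ σ² (A+1)² (τ+1)` (`ε = σ t_N`, `⌊τ/t_N⌋₊ + 1 ≤ (τ+1)(N+1)^{1/3}`,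
`(N+1)^{1/3} t_N = 1`). [folklore] -/
theorem norm_mul_longPairBound_le (σ : ℝ) {τ : ℝ} (hτ : 0 ≤ τ) (A : ℝ) (N : ℕ) :
    ((N : ℝ) + 1) ^ (1 / 3 : ℝ) * (hsDiameter σ N / ((N : ℝ) + 1)) ^ 2 *
        (((⌊τ / tN N⌋₊ : ℝ) + 1) * ((A + 1) * ((N : ℝ) + 1)) ^ 2) ≤ σ ^ 2 * (A + 1) ^ 2 * (τ + 1) := by
  have hN : (0 : ℝ) < (N : ℝ) + 1 := by positivity
  set Q : ℝ := ((N : ℝ) + 1) ^ (1 / 3 : ℝ) with hQ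
  have hQ0 : 0 < Q := by positivity
  have hQt : Q * tN N = 1 := by
    rw [hQ, tN, Real.rpow_neg hN.le, mul_inv_cancel₀ hQ0.ne']
  have hW : (⌊τ / tN N⌋₊ : ℝ) + 1 ≤ (τ + 1) * Q := by
    have := card_windows_le hτ N
    push_cast at this
    exact this
  have hε : hsDiameter σ N = σ * tN N := by
    rw [hsDiameter, tN, Nat.cast_succ]
  have hsq : (σ * tN N / ((N : ℝ) + 1)) ^ 2 * ((A + 1) * ((N : ℝ) + 1)) ^ 2 = σ ^ 2 * (A + 1) ^ 2 * tN N ^ 2 := by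
    field_simp
  rw [hε]
  calc Q * (σ * tN N / ((N : ℝ) + 1)) ^ 2 * (((⌊τ / tN N⌋₊ : ℝ) + 1) * ((A + 1) * ((N : ℝ) + 1)) ^ 2)
      = Q * ((σ * tN N / ((N : ℝ) + 1)) ^ 2 * ((A + 1) * ((N : ℝ) + 1)) ^ 2) * ((⌊τ / tN N⌋₊ : ℝ) + 1) := by ring
    _ = Q * (σ ^ 2 * (A + 1) ^ 2 * tN N ^ 2) * ((⌊τ / tN N⌋₊ : ℝ) + 1) := by rw [hsq]
    _ ≤ Q * (σ ^ 2 * (A + 1) ^ 2 * tN N ^ 2) * ((τ + 1) * Q) := mul_le_mul_of_nonneg_left hW (by positivity)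
    _ = σ ^ 2 * (A + 1) ^ 2 * (τ + 1) * (Q * tN N) ^ 2 := by ring
    _ = σ ^ 2 * (A + 1) ^ 2 * (τ + 1) := by rw [hQt, one_pow, mul_one]

/-- **STUB `sameWindowPairCovLongConst_of_decorrelation` — SWL AT CONSTANT PROFILES IS A PURE DECORRELATION STATEMENT**
(registered sub-goal of the line `kinetic-window-cut`, rev 5). Given `δ`, with `B := σ²(A+1)²(τ+1)` and `η := δ/(B+1)`,
take `N₀` from `FarPairDecorrelationLongConst` at `η`; pointwise `1_{LL far}|Γ| ≤ η 1_{LL sw} + 1_{LL far}(|Γ| − η)₊`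
(`far_term_le`, `sum4_split_le`), and `LG`-a.e. (good datum, genuine cut) the normalised long same-window pair count is `≤ B`
(`longSameWindowPairCount_le`, `norm_mul_longPairBound_le`), so `E ≤ η B + η = δ` (`LG` is a probability law for `σ ≤ 1/2`).
[folklore] -/
theorem sameWindowPairCovLongConst_of_decorrelation :
    FarPairDecorrelationLongConst rs → SameWindowPairCovLongConst rs := by
  intro hIII a θ u ha hθ
  obtain ⟨σ₂, hσ₂, h2⟩ := hIII a θ u ha hθ
  refine ⟨min σ₂ (1 / 2), lt_min hσ₂ (by norm_num), ?_⟩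
  intro σ hσ hσlt Φ τ hτ g hg hgb A hA δ hδ
  have hσ2' : σ < σ₂ := hσlt.trans_le (min_le_left _ _)
  have hσhalf : σ ≤ 1 / 2 := (hσlt.trans_le (min_le_right _ _)).le
  -- the deterministic bound of the normalised long same-window pair count, and the decorrelation target
  set B : ℝ := σ ^ 2 * (A + 1) ^ 2 * (τ + 1) with hBdef
  have hB0 : 0 ≤ B := by positivity
  set η : ℝ := δ / (B + 1) with hηdef
  have hη : 0 < η := div_pos hδ (by positivity)
  obtain ⟨N₀, hN₀⟩ := h2 σ hσ hσ2' Φ τ hτ g hg hgb A hA η hη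
  refine ⟨N₀, fun N hN => ?_⟩
  have hDN := hN₀ N hN
  haveI : IsProbabilityMeasure (localGibbsLaw σ (fun _ => a) (fun _ => u) (fun _ => θ) N (Φ N)) :=
    isProbabilityMeasure_localGibbsLaw continuous_const continuous_const continuous_const (fun _ => ha) (fun _ => hθ) hσhalf N (Φ N)
  set G := localGibbsLaw σ (fun _ => a) (fun _ => u) (fun _ => θ) N (Φ N) with hG
  set P : ℝ := ((N : ℝ) + 1) ^ (1 / 3 : ℝ) * (hsDiameter σ N / ((N : ℝ) + 1)) ^ 2 with hP
  have hP0 : 0 ≤ P := by rw [hP]; positivity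
  -- the three summands, as functions of the indices and the datum
  set sw : Fin (N + 1) → ℕ → Fin (N + 1) → ℕ → Phase N → ℝ := fun i n i' n' z =>
    if IsLong A (tN N) (past (Φ N) (rs N) z i n) ∧ IsLong A (tN N) (past (Φ N) (rs N) z i' n') ∧
        SameWindow (tN N) (past (Φ N) (rs N) z i n) (past (Φ N) (rs N) z i' n') then (1 : ℝ) else 0 with hsw
  set far : Fin (N + 1) → ℕ → Fin (N + 1) → ℕ → Phase N → ℝ := fun i n i' n' z =>
    if IsLong A (tN N) (past (Φ N) (rs N) z i n) ∧ IsLong A (tN N) (past (Φ N) (rs N) z i' n') ∧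
        PairFarL (rs N) A (tN N) (past (Φ N) (rs N) z i n) (past (Φ N) (rs N) z i' n') i i' then (1 : ℝ) else 0
    with hfar
  set Γ : Fin (N + 1) → ℕ → Fin (N + 1) → ℕ → Phase N → ℝ := fun i n i' n' z =>
    pairCondCovLG σ (fun _ => a) (fun _ => θ) (fun _ => u) (Φ N) (rs N) g i n i' n' z with hΓ
  -- pointwise split
  have hpt : ∀ z : Phase N,
      P * ∑ i : Fin (N + 1), ∑ n ∈ Finset.range (cnt (Φ N) τ z i),
          ∑ i' : Fin (N + 1), ∑ n' ∈ Finset.range (cnt (Φ N) τ z i'), far i n i' n' z * |Γ i n i' n' z| ≤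
        η * (P * ∑ i : Fin (N + 1), ∑ n ∈ Finset.range (cnt (Φ N) τ z i),
          ∑ i' : Fin (N + 1), ∑ n' ∈ Finset.range (cnt (Φ N) τ z i'), sw i n i' n' z) +
        P * ∑ i : Fin (N + 1), ∑ n ∈ Finset.range (cnt (Φ N) τ z i),
          ∑ i' : Fin (N + 1), ∑ n' ∈ Finset.range (cnt (Φ N) τ z i'),
            far i n i' n' z * max (|Γ i n i' n' z| - η) 0 := by
    intro z
    have hs := sum4_split_le (fun i => cnt (Φ N) τ z i) (fun i n i' n' => far i n i' n' z * |Γ i n i' n' z|)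
      (fun i n i' n' => sw i n i' n' z) (fun i n i' n' => far i n i' n' z * max (|Γ i n i' n' z| - η) 0) η
      (fun i n i' n' => by
        simp only [hfar, hsw]
        exact far_term_le (fun h => ⟨h.1, h.2.1, h.2.2.1⟩) _ hη.le)
    have := mul_le_mul_of_nonneg_left hs hP0
    linarith [this]
  -- the count part is deterministically bounded where the datum is good and the cut is genuine (`LG`-a.e.)
  have hgood : ∀ᵐ z ∂G, z ∈ (Φ N).good := mem_ae_iff.2 (localGibbsLaw_compl_good_eq_zero (Φ N))
  have haecut := ae_forall_lt_cnt_iff_pastTime (a₀ := fun _ => a) (θ₀ := fun _ => θ) (u₀ := fun _ => u) hσhalf (Φ N) τ (rs N)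
  have hcount : ∀ᵐ z ∂G, P * ∑ i : Fin (N + 1), ∑ n ∈ Finset.range (cnt (Φ N) τ z i),
      ∑ i' : Fin (N + 1), ∑ n' ∈ Finset.range (cnt (Φ N) τ z i'), sw i n i' n' z ≤ B := by
    filter_upwards [hgood, haecut] with z hz hcut
    have hgen : ∀ i : Fin (N + 1), ∀ n : ℕ, n < cnt (Φ N) τ z i → (Φ N).nthCollisionTimeOf i n z ∈ Set.Ioc 0 τ := by
      intro i n hn
      have h := (hcut i n).1 hn
      rwa [show (past (Φ N) (rs N) z i n).2.2.2 = (Φ N).nthCollisionTimeOf i n z by simp [past, hz]] at h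
    have hS := longSameWindowPairCount_le σ N (Φ N) τ (rs N) A hA z hz hgen
    calc P * ∑ i : Fin (N + 1), ∑ n ∈ Finset.range (cnt (Φ N) τ z i),
          ∑ i' : Fin (N + 1), ∑ n' ∈ Finset.range (cnt (Φ N) τ z i'), sw i n i' n' z
        ≤ P * (((⌊τ / tN N⌋₊ : ℝ) + 1) * ((A + 1) * ((N : ℝ) + 1)) ^ 2) := mul_le_mul_of_nonneg_left hS hP0
      _ ≤ B := norm_mul_longPairBound_le σ hτ.le A N
  have hae : ∀ᵐ z ∂G,
      ENNReal.ofReal (P * ∑ i : Fin (N + 1), ∑ n ∈ Finset.range (cnt (Φ N) τ z i),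
          ∑ i' : Fin (N + 1), ∑ n' ∈ Finset.range (cnt (Φ N) τ z i'), far i n i' n' z * |Γ i n i' n' z|) ≤
        ENNReal.ofReal (η * B) +
          ENNReal.ofReal (P * ∑ i : Fin (N + 1), ∑ n ∈ Finset.range (cnt (Φ N) τ z i),
            ∑ i' : Fin (N + 1), ∑ n' ∈ Finset.range (cnt (Φ N) τ z i'),
              far i n i' n' z * max (|Γ i n i' n' z| - η) 0) := by
    filter_upwards [hcount] with z hz
    refine (ENNReal.ofReal_le_ofReal ((hpt z).trans ?_)).trans ENNReal.ofReal_add_le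
    exact add_le_add (mul_le_mul_of_nonneg_left hz hη.le) le_rfl
  -- assemble
  calc ∫⁻ z, ENNReal.ofReal (P * ∑ i : Fin (N + 1), ∑ n ∈ Finset.range (cnt (Φ N) τ z i),
          ∑ i' : Fin (N + 1), ∑ n' ∈ Finset.range (cnt (Φ N) τ z i'), far i n i' n' z * |Γ i n i' n' z|) ∂G
      ≤ ∫⁻ z, (ENNReal.ofReal (η * B) +
          ENNReal.ofReal (P * ∑ i : Fin (N + 1), ∑ n ∈ Finset.range (cnt (Φ N) τ z i),
            ∑ i' : Fin (N + 1), ∑ n' ∈ Finset.range (cnt (Φ N) τ z i'),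
              far i n i' n' z * max (|Γ i n i' n' z| - η) 0)) ∂G := lintegral_mono_ae hae
    _ = ENNReal.ofReal (η * B) +
          ∫⁻ z, ENNReal.ofReal (P * ∑ i : Fin (N + 1), ∑ n ∈ Finset.range (cnt (Φ N) τ z i),
            ∑ i' : Fin (N + 1), ∑ n' ∈ Finset.range (cnt (Φ N) τ z i'),
              far i n i' n' z * max (|Γ i n i' n' z| - η) 0) ∂G := by
        rw [lintegral_add_left measurable_const, lintegral_const, measure_univ, mul_one]
    _ ≤ ENNReal.ofReal (η * B) + ENNReal.ofReal η := add_le_add le_rfl hDN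
    _ = ENNReal.ofReal δ := by
        rw [← ENNReal.ofReal_add (by positivity) hη.le]
        congr 1
        have hB1 : B + 1 ≠ 0 := by positivity
        calc η * B + η = η * (B + 1) := by ring
          _ = δ := by rw [hηdef]; exact div_mul_cancel₀ δ hB1

end Summit.AtomisticToContinuum.HydrodynamicLimit.Theorems.KickFairRelEquilibriumMesoLine

end
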